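import Literature.MathematicalPhysics.QuantumLattice.TorusSectorGibbsEntropyRowPressureInput
import Literature.MathematicalPhysics.QuantumLattice.FermionLiebCertificate
import HarnessLib

/-!
# The conditional entropy row («cent») of the canonical sector Gibbs state with a PRESSURE-FLOOR input

Topic `MathematicalPhysics/QuantumLattice`; companion of `TorusSectorGibbsCondEntropyRow.lean` (input = the
ground-state energy density) and `TorusSectorGibbsEntropyRowPressureInput.lean` (the «ent» row with a pressure-floor
input). For the canonical Gibbs density `ρ_{L,β}` (`S(ρ_{L,β}) = log Z_K(L) + β E_β(L)`), a window `Λ ⊆ [0,ℓ)²`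
with lexicographically largest site `a`, the Markov window bound `S(ρ) ≤ N_w·(S(ρ_Λ) − S(ρ_{Λ∖a})) + (L² − N_w)·log 4`
and ANY conditional free-energy bound `∀σ: S(σ) − S(σ_{Λ∖a}) − Re tr(σ H) ≤ c`:

* §1 `sectorGibbs_energy_add_log_partitionFn_le_window_of_forall_density` (finite volume, identity form):
  `β E_β(L) + log Re Z_K(L) ≤ N_w·(Σ_i p_{L,i} Re torusAvgExpectAt L Λ H ψ_{L,i} + c) + (L² − N_w)·log 4`;
* §2 `InfVolFermionState.IsTorusLimitOfMixture.meanEnergy_sub_re_expect_div_le_of_sectorGibbs_window_of_pressureFloor`: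
  for every torus limit `ω` of the canonical sector Gibbs states at `β > 0` along `Ls → ∞` (`0 ≤ n ≤ 2`) and every
  `W` with `∀ ε > 0, ∀ᶠ j, (W − ε)(Ls j)² ≤ log Re Z_β^{sector}(Ls j)`:  `e_Φ(ω) − Re ω_Λ(H)/β ≤ −W/β + c/β`;
* §3 the same as the extra row `0 ≤ Re ω_{Λ'}((f + c/β)·1 − Γ E_Φ + (1/β)·Γ_{Λ⊆Λ'} H)` of the thermal reader
  (`f ≥ −W/β`);
* §4 instances: the Löwner dual certificate `(L_B, c)` of `FermionConditionalFreeEnergyCertificate.lean`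
  (`…_window_of_pressureFloor_of_certificate`) and the Lieb-constant certificate of `FermionLiebCertificate.lean`
  (`…_window_of_pressureFloor_lieb`).

Everything is PROVED; no definition, no named fact.

References: Poulin–Hastings 2011 eqs. (3)–(8) [PoulinHastings2011]; Araki–Moriya 2003 Thm. 3.8/§10
[ArakiMoriya2003]; Israel 1979 Lemma II.3.1 [Israel1979]; Lieb 1973 Thms 6–7 [Lieb1973ConvexTrace];
Friedli–Velenik 2017 §6.9 [FriedliVelenik2017].
-/

noncomputable section

namespace Literature.MathematicalPhysics.QuantumLattice

open Matrix Finset HubbardWave0 Literature.Probability.LatticeModels ThermodynamicLimit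
open Literature.InformationTheory.Entropy (vonNeumannEntropy)
open Literature.LinearAlgebra.Matrix (logFrechet)
open _root_.Filter
open scoped _root_.Topology ComplexOrder BigOperators

/-! ### §1 Finite volume: the row in identity form -/

section Finite

variable (L : ℕ) [NeZero L]

/-- The shield of a pulled-back window is the pulled-back shield (`tr_{Λ→Λ∖a} ∘ tr_{torus→Λ} = tr_{torus→Λ∖a}`).
[folklore] -/
private theorem incl_erase_trans_toTorusEmb'' {Λ : Finset (Site 2)} (a : Site 2) {ℓ : ℕ}
    (hΛ : Λ ⊆ halfOpenBox 2 ℓ) (hℓL : ℓ ≤ L) :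
    (PolySite.incl (Λ.erase_subset a)).trans (PolySite.toTorusEmb L (injOn_proj_of_subset_halfOpenBox' hΛ hℓL)) =
      PolySite.toTorusEmb L (injOn_proj_of_subset_halfOpenBox' ((Λ.erase_subset a).trans hΛ) hℓL) :=
  DFunLike.ext _ _ fun _ => rfl

/-- **Finite-volume conditional-entropy row of the canonical sector Gibbs state, identity form.** For
`0 ≤ n ≤ 2`, a window `Λ ⊆ [0,ℓ)²` (`ℓ ≤ L`) with lexicographically largest site `a`, an operator `H ∈ 𝔄_Λ`, a
real `c` and the bound `S(σ) − S(σ_{Λ∖a}) − Re tr(σ H) ≤ c` for EVERY density matrix `σ ∈ 𝔄_Λ`: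
`β E_β(L) + log Re Z_K(L) ≤ N_w·(Σ_i p_{L,i} Re torusAvgExpectAt L Λ H ψ_{L,i} + c) + (L² − N_w)·log 4`, `N_w = (L+1−ℓ)²`
(`S(ρ_{L,β}) = log Z_K + β E_β`; Markov window bound for the even TI density `ρ_{L,β}`; the bound on the window
marginal; translation invariance). [cite: PoulinHastings2011, eqs. (3)–(8)] [cite: ArakiMoriya2003, Theorem 3.8 and §10] -/
theorem sectorGibbs_energy_add_log_partitionFn_le_window_of_forall_density (t t' U : ℝ) {n : ℝ}
    (hn0 : 0 ≤ n) (hn2 : n ≤ 2) (β : ℝ) {Λ : Finset (Site 2)} {a : Site 2} (ha : a ∈ Λ)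
    (hmax : ∀ y ∈ Λ, toLex y ≤ toLex a) {ℓ : ℕ} (hΛ : Λ ⊆ halfOpenBox 2 ℓ) (hℓL : ℓ ≤ L)
    (H : FermionOp Λ) {c : ℝ}
    (hrow : ∀ σ : FermionOp Λ, σ.PosSemidef → σ.trace = 1 →
      vonNeumannEntropy σ - vonNeumannEntropy (fermionPartialTrace (PolySite.incl (Finset.erase_subset a Λ)) σ) -
        (σ * H).trace.re ≤ c) :
    β * (∑ i, sectorGibbsWeightTT' β t t' U n L i *
          (expect (hubbardTorusTT' L t t' U) (sectorGibbsVectorTT' t t' U n L i)).re) +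
        Real.log (partitionFn β (sectorHamiltonianTT' t t' U n L)).re ≤
      (((L + 1 - ℓ) ^ 2 : ℕ) : ℝ) *
          (∑ i, sectorGibbsWeightTT' β t t' U n L i *
              (torusAvgExpectAt L Λ H (sectorGibbsVectorTT' t t' U n L i)).re + c) +
        (((L ^ 2 : ℕ) : ℝ) - (((L + 1 - ℓ) ^ 2 : ℕ) : ℝ)) * Real.log 4 := by
  set ρ := sectorGibbsDensityTT' L β t t' U n with hρ
  have hρpsd : ρ.PosSemidef := posSemidef_sectorGibbsDensityTT' L β t t' U n
  have hρtr : ρ.trace = 1 := trace_sectorGibbsDensityTT' L β t t' U hn0 hn2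
  -- thermodynamics: `S(ρ) = log Z_K + β E_β`
  have h1 : vonNeumannEntropy ρ = Real.log (partitionFn β (sectorHamiltonianTT' t t' U n L)).re +
      β * (∑ i, sectorGibbsWeightTT' β t t' U n L i *
        (expect (hubbardTorusTT' L t t' U) (sectorGibbsVectorTT' t t' U n L i)).re) := by
    rw [hρ, vonNeumannEntropy_sectorGibbsDensityTT' L β t t' U hn0 hn2,
      ← re_trace_sectorGibbsDensityTT'_mul_hubbardTorusTT', re_trace_sectorGibbsDensityTT'_mul]
  -- Markov window bound for the even TI density
  have h2 := torus_vonNeumannEntropy_le_window L hρpsd hρtr (parityAut_sectorGibbsDensityTT' L β t t' U n)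
    (relabel_translate_sectorGibbsDensityTT' L β t t' U n) ha hmax hΛ hℓL
  -- the bound on the window marginal
  set hinj := injOn_proj_of_subset_halfOpenBox' hΛ hℓL with hinj_def
  set σ : FermionOp Λ := fermionPartialTrace (PolySite.toTorusEmb L hinj) ρ with hσ
  have hσpsd : σ.PosSemidef := posSemidef_fermionPartialTrace _ hρpsd
  have hσtr : σ.trace = 1 := by rw [hσ, trace_fermionPartialTrace, hρtr]
  have h3 := hrow σ hσpsd hσtr
  have hshield : fermionPartialTrace (PolySite.incl (Finset.erase_subset a Λ)) σ =
      fermionPartialTrace (PolySite.toTorusEmb L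
        (injOn_proj_of_subset_halfOpenBox' ((Λ.erase_subset a).trans hΛ) hℓL)) ρ := by
    rw [hσ, ← fermionPartialTrace_trans, incl_erase_trans_toTorusEmb'' L a hΛ hℓL]
  rw [hshield] at h3
  have htrace : (σ * H).trace.re =
      ∑ i, sectorGibbsWeightTT' β t t' U n L i * (torusAvgExpectAt L Λ H (sectorGibbsVectorTT' t t' U n L i)).re := by
    rw [Matrix.trace_mul_comm, hσ, trace_mul_fermionPartialTrace,
      re_trace_fermionEmbed_toTorusEmb_mul_sectorGibbsDensityTT']
  rw [htrace] at h3
  have hN : (0 : ℝ) ≤ (((L + 1 - ℓ) ^ 2 : ℕ) : ℝ) := Nat.cast_nonneg _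
  have h4 := mul_le_mul_of_nonneg_left (show vonNeumannEntropy σ -
      vonNeumannEntropy (fermionPartialTrace (PolySite.toTorusEmb L
        (injOn_proj_of_subset_halfOpenBox' ((Λ.erase_subset a).trans hΛ) hℓL)) ρ) ≤
      ∑ i, sectorGibbsWeightTT' β t t' U n L i * (torusAvgExpectAt L Λ H (sectorGibbsVectorTT' t t' U n L i)).re + c
      by linarith) hN
  have h5 := add_le_add h4 (le_refl ((((L ^ 2 : ℕ) : ℝ) - (((L + 1 - ℓ) ^ 2 : ℕ) : ℝ)) * Real.log 4))
  have h1' : β * (∑ i, sectorGibbsWeightTT' β t t' U n L i *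
          (expect (hubbardTorusTT' L t t' U) (sectorGibbsVectorTT' t t' U n L i)).re) +
        Real.log (partitionFn β (sectorHamiltonianTT' t t' U n L)).re = vonNeumannEntropy ρ := by
    rw [h1, add_comm]
  exact h1'.le.trans (h2.trans h5)

end Finite

/-! ### §2 The thermodynamic limit with a pressure floor -/

section Limit

/-- From `βE + ℓ' ≤ N(A + c) + (L² − N)·l₄`, `(W − ε₁)L² ≤ ℓ'`, `N ≤ L²`, `|A| ≤ M`, `δ = 1 − N/L²`:
`E/L² − A/β ≤ −W/β + c/β + (ε₁/β + δ(l₄ + M + |c|)/β)`. [folklore] -/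
private theorem row_algebra_window_pressure {β Lsq N E ℓ' W ε₁ A c M δ l4 : ℝ} (hβ : 0 < β) (hL : 0 < Lsq)
    (hrow : β * E + ℓ' ≤ N * (A + c) + (Lsq - N) * l4) (hW : (W - ε₁) * Lsq ≤ ℓ') (hN : N ≤ Lsq)
    (hA : |A| ≤ M) (hδ : δ = 1 - N / Lsq) :
    E / Lsq - 1 / β * A ≤ -W / β + c / β + (ε₁ / β + δ * (l4 + M + |c|) / β) := by
  have hδ0 : 0 ≤ δ := by
    rw [hδ, sub_nonneg, div_le_one hL]
    exact hN
  have e1 : N - Lsq = -(Lsq * δ) := by rw [hδ]; field_simp; ring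
  have hLδ : 0 ≤ Lsq * δ := mul_nonneg hL.le hδ0
  have hA' : -A ≤ M := (neg_le_abs A).trans hA
  have hc : -c ≤ |c| := neg_le_abs c
  have key : (N - Lsq) * A + (N - Lsq) * c + (Lsq - N) * l4 ≤ Lsq * (δ * (l4 + M + |c|)) := by
    rw [show Lsq - N = Lsq * δ by linarith [e1], e1]
    have h1 : -(Lsq * δ) * A ≤ Lsq * δ * M := by
      rw [neg_mul, ← mul_neg]; exact mul_le_mul_of_nonneg_left hA' hLδ
    have h2 : -(Lsq * δ) * c ≤ Lsq * δ * |c| := by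
      rw [neg_mul, ← mul_neg]; exact mul_le_mul_of_nonneg_left hc hLδ
    nlinarith
  have hβL : 0 < β * Lsq := mul_pos hβ hL
  rw [show E / Lsq - 1 / β * A = (β * E - Lsq * A) / (β * Lsq) by field_simp,
    show -W / β + c / β + (ε₁ / β + δ * (l4 + M + |c|) / β) =
      (-(W - ε₁) * Lsq + Lsq * c + Lsq * (δ * (l4 + M + |c|))) / (β * Lsq) by field_simp; ring,
    div_le_div_iff_of_pos_right hβL]
  nlinarith

/-- `(L + 1 − ℓ)² / L² → 1`. [cite: FriedliVelenik2017, §6.9] -/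
private theorem tendsto_sq_sub_div_sq'' (ℓ : ℕ) :
    Tendsto (fun L : ℕ => ((L + 1 - ℓ : ℕ) : ℝ) ^ 2 / (L : ℝ) ^ 2) atTop (𝓝 1) := by
  have h0 : Tendsto (fun L : ℕ => 1 + (1 - (ℓ : ℝ)) / (L : ℝ)) atTop (𝓝 (1 + 0)) :=
    tendsto_const_nhds.add (tendsto_const_div_atTop_nhds_zero_nat _)
  rw [add_zero] at h0
  have h := h0.mul h0
  rw [mul_one] at h
  refine h.congr' ?_
  filter_upwards [eventually_ge_atTop (ℓ + 1)] with L hL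
  have hL' : (L : ℝ) ≠ 0 := Nat.cast_ne_zero.2 (by omega)
  rw [Nat.cast_sub (by omega)]
  field_simp
  push_cast
  ring

namespace InfVolFermionState

/-- **The CONDITIONAL ENTROPY ROW for thermal torus limits with a pressure-floor input.** Let `ω` be a torus
limit of the canonical `(rectN n L, S^z = 0)` Gibbs states of `hubbardTorusTT' L t t' U` at `β > 0` along `Ls → ∞`
(`0 ≤ n ≤ 2`), `W` a real with `∀ ε > 0, ∀ᶠ j, (W − ε)(Ls j)² ≤ log Re Z_β(sectorHamiltonianTT' t t' U n (Ls j))`,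
`Λ ⊆ [0,ℓ)²` a window with lexicographically largest site `a`, `H ∈ 𝔄_Λ` and `c` real with
`S(σ) − S(σ_{Λ∖a}) − Re tr(σ H) ≤ c` for every density matrix `σ ∈ 𝔄_Λ`. Then
`e_{Φ(t,t',U)}(ω) − Re ω_Λ(H)/β ≤ −W/β + c/β`. [cite: PoulinHastings2011, eqs. (3)–(8)]
[cite: ArakiMoriya2003, Theorem 3.8 and §10] -/
theorem IsTorusLimitOfMixture.meanEnergy_sub_re_expect_div_le_of_sectorGibbs_window_of_pressureFloor
    (t t' U : ℝ) {n : ℝ} (hn0 : 0 ≤ n) (hn2 : n ≤ 2) {β : ℝ} (hβ : 0 < β)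
    {ω : InfVolFermionState 2} {Ls : ℕ → ℕ}
    (h : ω.IsTorusLimitOfMixture (sectorGibbsCount n) (fun L => sectorGibbsWeightTT' β t t' U n L)
      (fun L => sectorGibbsVectorTT' t t' U n L) Ls)
    (hLs : Tendsto Ls atTop atTop) {W : ℝ}
    (hW : ∀ ε : ℝ, 0 < ε → ∀ᶠ j in atTop,
      (W - ε) * (Ls j : ℝ) ^ 2 ≤ Real.log (partitionFn β (sectorHamiltonianTT' t t' U n (Ls j))).re)
    {Λ : Finset (Site 2)} {a : Site 2} (ha : a ∈ Λ) (hmax : ∀ y ∈ Λ, toLex y ≤ toLex a) {ℓ : ℕ}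
    (hΛ : Λ ⊆ halfOpenBox 2 ℓ) (H : FermionOp Λ) {c : ℝ}
    (hrow : ∀ σ : FermionOp Λ, σ.PosSemidef → σ.trace = 1 →
      vonNeumannEntropy σ - vonNeumannEntropy (fermionPartialTrace (PolySite.incl (Finset.erase_subset a Λ)) σ) -
        (σ * H).trace.re ≤ c) :
    ω.meanEnergy (hubbardTTPrimeFermionInteraction t t' U) 1 - 1 / β * (ω.expect Λ H).re ≤ -W / β + c / β := by
  set M : ℝ := ∑ s, ∑ t, ‖H s t‖ with hMdef
  set K : ℝ := Real.log 4 + M + |c| with hK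
  have hδ : Tendsto (fun j : ℕ => (1 - ((Ls j + 1 - ℓ : ℕ) : ℝ) ^ 2 / (Ls j : ℝ) ^ 2) * K / β) atTop (𝓝 0) := by
    have h1 := ((tendsto_const_nhds (x := (1 : ℝ))).sub (tendsto_sq_sub_div_sq'' ℓ)).comp hLs
    rw [sub_self] at h1
    have h2 := (h1.mul_const K).div_const β
    rw [zero_mul, zero_div] at h2
    exact h2
  have key := h.mul_meanEnergy_add_mul_re_expect_le_of_eventually_subseq t t' U hLs Λ H
    (a := 1) (κ := -(1 / β)) (c := c / β) (γ := -W / β) (g := fun _ => -W / β) tendsto_const_nhds ?_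
  · simpa [sub_eq_add_neg] using key
  intro ε hε
  have hε2 : 0 < ε / 2 := by linarith
  have hβε : 0 < β * (ε / 2) := mul_pos hβ hε2
  filter_upwards [hδ.eventually (gt_mem_nhds hε2), hW (β * (ε / 2)) hβε, hLs.eventually_ge_atTop (ℓ + 1)]
    with j hδj hWj hLj
  haveI : NeZero (Ls j) := ⟨by omega⟩
  have hℓL : ℓ ≤ Ls j := by omega
  have hℓ1 : 1 ≤ ℓ := by
    have h0 := (mem_halfOpenBox.1 (hΛ ha)) 0
    omega
  have hL0 : (0 : ℝ) < (Ls j : ℝ) := Nat.cast_pos.2 (NeZero.pos (Ls j))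
  have hLsq : (0 : ℝ) < (Ls j : ℝ) ^ 2 := by positivity
  have hrowL := sectorGibbs_energy_add_log_partitionFn_le_window_of_forall_density (Ls j) t t' U hn0 hn2 β ha hmax
    hΛ hℓL H hrow
  push_cast at hrowL
  have havg : (∑ i, (sectorGibbsWeightTT' β t t' U n (Ls j) i : ℂ) *
        torusAvgExpect (Ls j) Λ H (sectorGibbsVectorTT' t t' U n (Ls j) i)).re =
      ∑ i, sectorGibbsWeightTT' β t t' U n (Ls j) i *
        (torusAvgExpectAt (Ls j) Λ H (sectorGibbsVectorTT' t t' U n (Ls j) i)).re := by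
    rw [Complex.re_sum]
    refine Finset.sum_congr rfl fun i _ => ?_
    rw [Complex.re_ofReal_mul, torusAvgExpect_eq]
  have hA : |∑ i, sectorGibbsWeightTT' β t t' U n (Ls j) i *
      (torusAvgExpectAt (Ls j) Λ H (sectorGibbsVectorTT' t t' U n (Ls j) i)).re| ≤ M := by
    have h := abs_sum_mul_re_torusAvgExpect_le (Ls j) Λ H
      (fun i => sectorGibbsWeightTT' β t t' U n (Ls j) i) (fun i => sectorGibbsVectorTT' t t' U n (Ls j) i)
      (fun i => sectorGibbsWeightTT'_nonneg β t t' U n (Ls j) i) (sum_sectorGibbsWeightTT' β t t' U hn0 hn2 (Ls j))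
      (fun i => star_sectorGibbsVectorTT'_dotProduct_self t t' U n (Ls j) i)
    simp_rw [torusAvgExpect_eq] at h
    exact h
  have henergy : ∑ i, sectorGibbsWeightTT' β t t' U n (Ls j) i *
        ((QuantumLattice.expect (hubbardTorusTT' (Ls j) t t' U) (sectorGibbsVectorTT' t t' U n (Ls j) i)).re /
          (Ls j : ℝ) ^ 2) =
      (∑ i, sectorGibbsWeightTT' β t t' U n (Ls j) i *
        (QuantumLattice.expect (hubbardTorusTT' (Ls j) t t' U) (sectorGibbsVectorTT' t t' U n (Ls j) i)).re) /
          (Ls j : ℝ) ^ 2 := by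
    rw [Finset.sum_div]
    refine Finset.sum_congr rfl fun i _ => ?_
    ring
  have hNle : ((Ls j + 1 - ℓ : ℕ) : ℝ) ^ 2 ≤ (Ls j : ℝ) ^ 2 := by
    have : ((Ls j + 1 - ℓ : ℕ) : ℝ) ≤ (Ls j : ℝ) := by exact_mod_cast (show Ls j + 1 - ℓ ≤ Ls j by omega)
    exact pow_le_pow_left₀ (Nat.cast_nonneg _) this 2
  have halg := row_algebra_window_pressure hβ hLsq hrowL hWj hNle hA rfl
  have hε1 : β * (ε / 2) / β = ε / 2 := by field_simp
  rw [hε1] at halg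
  rw [havg, henergy, one_mul]
  linarith

/-! ### §3 The row in the thermal reader's shape -/

/-- Evaluation of an affine extra row: `Re ω_{Λ'}(r·1 − Γ E_Φ + s·Γ A) = r − e_Φ(ω) + s·Re ω(A)`. [folklore] -/
private theorem re_expect_affineRow''' (ω : InfVolFermionState 2) (t t' U : ℝ) {Λ Λ' : Finset (Site 2)}
    (hΛ : Λ ⊆ Λ') (h0 : thicken ({0} : Finset (Site 2)) 1 ⊆ Λ') (A : FermionOp Λ) (r s : ℝ) :
    (ω.expect Λ' (((r : ℝ) : ℂ) • (1 : FermionOp Λ') -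
        fermionEmbed (PolySite.incl h0) ((hubbardTTPrimeFermionInteraction t t' U).meanEnergyObs 1) +
        ((s : ℝ) : ℂ) • fermionEmbed (PolySite.incl hΛ) A)).re =
      r - ω.meanEnergy (hubbardTTPrimeFermionInteraction t t' U) 1 + s * (ω.expect Λ A).re := by
  rw [map_add, map_sub, map_smul, map_smul, ω.expect_one, ω.compatible h0, ω.compatible hΛ, meanEnergy]
  simp only [smul_eq_mul, mul_one, Complex.add_re, Complex.sub_re, Complex.ofReal_re, Complex.re_ofReal_mul]

/-- **The «cent» row with a pressure-floor input as an extra row of the thermal reader.** Same hypotheses as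
`…_window_of_pressureFloor`, `Λ ⊆ Λ'`, `thicken {0} 1 ⊆ Λ'`, and a constant `−W/β ≤ f`:
`0 ≤ Re ω_{Λ'}((f + c/β)·1 − Γ E_Φ + (1/β)·Γ_{Λ⊆Λ'} H)`. [cite: PoulinHastings2011, eqs. (3)–(8)]
[cite: ArakiMoriya2003, Theorem 3.8 and §10] -/
theorem IsTorusLimitOfMixture.re_expect_centRow_nonneg_of_sectorGibbs_of_pressureFloor
    (t t' U : ℝ) {n : ℝ} (hn0 : 0 ≤ n) (hn2 : n ≤ 2) {β : ℝ} (hβ : 0 < β)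
    {ω : InfVolFermionState 2} {Ls : ℕ → ℕ}
    (h : ω.IsTorusLimitOfMixture (sectorGibbsCount n) (fun L => sectorGibbsWeightTT' β t t' U n L)
      (fun L => sectorGibbsVectorTT' t t' U n L) Ls)
    (hLs : Tendsto Ls atTop atTop) {W : ℝ}
    (hW : ∀ ε : ℝ, 0 < ε → ∀ᶠ j in atTop,
      (W - ε) * (Ls j : ℝ) ^ 2 ≤ Real.log (partitionFn β (sectorHamiltonianTT' t t' U n (Ls j))).re)
    {Λ : Finset (Site 2)} {a : Site 2} (ha : a ∈ Λ) (hmax : ∀ y ∈ Λ, toLex y ≤ toLex a) {ℓ : ℕ}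
    (hΛℓ : Λ ⊆ halfOpenBox 2 ℓ) (H : FermionOp Λ) {c : ℝ}
    (hrow : ∀ σ : FermionOp Λ, σ.PosSemidef → σ.trace = 1 →
      vonNeumannEntropy σ - vonNeumannEntropy (fermionPartialTrace (PolySite.incl (Finset.erase_subset a Λ)) σ) -
        (σ * H).trace.re ≤ c)
    {Λ' : Finset (Site 2)} (hΛ : Λ ⊆ Λ') (h0 : thicken ({0} : Finset (Site 2)) 1 ⊆ Λ')
    {f : ℝ} (hf : -W / β ≤ f) :
    0 ≤ (ω.expect Λ' ((((f + c / β : ℝ)) : ℂ) • (1 : FermionOp Λ') -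
        fermionEmbed (PolySite.incl h0) ((hubbardTTPrimeFermionInteraction t t' U).meanEnergyObs 1) +
        ((1 / β : ℝ) : ℂ) • fermionEmbed (PolySite.incl hΛ) H)).re := by
  rw [re_expect_affineRow''']
  have hrow' := h.meanEnergy_sub_re_expect_div_le_of_sectorGibbs_window_of_pressureFloor t t' U hn0 hn2 hβ hLs hW
    ha hmax hΛℓ H hrow
  linarith

/-! ### §4 Instances: the Löwner dual certificate and the Lieb certificate -/

/-- **The «cent» row with a pressure-floor input and a Löwner dual certificate `(L_B, c)`** (`H, L_B` Hermitian,
`e^c·e^{L_B} − tr_{Λ→Λ∖a} exp(−H + Γ L_B) ⪰ 0`; constants 'gt' = `L_B = 0`, 'lb' = `L_B = −G_W`):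
`e_Φ(ω) − Re ω_Λ(H)/β ≤ −W/β + c/β`. [cite: PoulinHastings2011, eqs. (3)–(8)] [cite: Lindblad1975, Lemma 2 p.149] -/
theorem IsTorusLimitOfMixture.meanEnergy_sub_re_expect_div_le_of_sectorGibbs_window_of_pressureFloor_of_certificate
    (t t' U : ℝ) {n : ℝ} (hn0 : 0 ≤ n) (hn2 : n ≤ 2) {β : ℝ} (hβ : 0 < β)
    {ω : InfVolFermionState 2} {Ls : ℕ → ℕ}
    (h : ω.IsTorusLimitOfMixture (sectorGibbsCount n) (fun L => sectorGibbsWeightTT' β t t' U n L)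
      (fun L => sectorGibbsVectorTT' t t' U n L) Ls)
    (hLs : Tendsto Ls atTop atTop) {W : ℝ}
    (hW : ∀ ε : ℝ, 0 < ε → ∀ᶠ j in atTop,
      (W - ε) * (Ls j : ℝ) ^ 2 ≤ Real.log (partitionFn β (sectorHamiltonianTT' t t' U n (Ls j))).re)
    {Λ : Finset (Site 2)} {a : Site 2} (ha : a ∈ Λ) (hmax : ∀ y ∈ Λ, toLex y ≤ toLex a) {ℓ : ℕ}
    (hΛ : Λ ⊆ halfOpenBox 2 ℓ) {H : FermionOp Λ} (hH : H.IsHermitian) {LB : FermionOp (Λ.erase a)}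
    (hLB : LB.IsHermitian) {c : ℝ}
    (hcert : ((Real.exp c : ℂ) • cfc Real.exp LB -
      fermionPartialTrace (PolySite.incl (Finset.erase_subset a Λ))
        (cfc Real.exp (-H + fermionEmbed (PolySite.incl (Finset.erase_subset a Λ)) LB))).PosSemidef) :
    ω.meanEnergy (hubbardTTPrimeFermionInteraction t t' U) 1 - 1 / β * (ω.expect Λ H).re ≤ -W / β + c / β :=
  h.meanEnergy_sub_re_expect_div_le_of_sectorGibbs_window_of_pressureFloor t t' U hn0 hn2 hβ hLs hW ha hmax hΛ H
    fun _ hσ hσtr => fermion_condFreeEnergy_le_of_certificate ha hmax hσ hσtr hH hLB hcert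

/-- **The «cent» row with a pressure-floor input and the LIEB constant** (`G ∈ 𝔄_Λ` Hermitian,
`G_W = V diag(u) V⋆`, `Z⁺ − tr_{Λ→Λ∖a} e^{−G} ⪰ 0`, `e^c·1 − dlog_{V,e^{−u}}[Z⁺] ⪰ 0`):
`e_Φ(ω) − Re ω_Λ(G − Γ G_W)/β ≤ −W/β + c/β`. [cite: Lieb1973ConvexTrace, Theorems 6–7]
[cite: PoulinHastings2011, eqs. (3)–(8)] -/
theorem IsTorusLimitOfMixture.meanEnergy_sub_re_expect_div_le_of_sectorGibbs_window_of_pressureFloor_lieb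
    (t t' U : ℝ) {n : ℝ} (hn0 : 0 ≤ n) (hn2 : n ≤ 2) {β : ℝ} (hβ : 0 < β)
    {ω : InfVolFermionState 2} {Ls : ℕ → ℕ}
    (h : ω.IsTorusLimitOfMixture (sectorGibbsCount n) (fun L => sectorGibbsWeightTT' β t t' U n L)
      (fun L => sectorGibbsVectorTT' t t' U n L) Ls)
    (hLs : Tendsto Ls atTop atTop) {W : ℝ}
    (hW : ∀ ε : ℝ, 0 < ε → ∀ᶠ j in atTop,
      (W - ε) * (Ls j : ℝ) ^ 2 ≤ Real.log (partitionFn β (sectorHamiltonianTT' t t' U n (Ls j))).re)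
    {Λ : Finset (Site 2)} {a : Site 2} (ha : a ∈ Λ) (hmax : ∀ y ∈ Λ, toLex y ≤ toLex a) {ℓ : ℕ}
    (hΛ : Λ ⊆ halfOpenBox 2 ℓ) {G : FermionOp Λ} (hG : G.IsHermitian) {GW Zp V : FermionOp (Λ.erase a)}
    {u : Finset (Orb (PolySite (Λ.erase a))) → ℝ} {c : ℝ}
    (hV : V ∈ Matrix.unitaryGroup (Finset (Orb (PolySite (Λ.erase a)))) ℂ)
    (hGW : GW = V * diagonal (fun k => ((u k : ℝ) : ℂ)) * star V)
    (hZ : (Zp - fermionPartialTrace (PolySite.incl (Finset.erase_subset a Λ)) (cfc Real.exp (-G))).PosSemidef)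
    (hcert : (((Real.exp c : ℝ) : ℂ) • (1 : FermionOp (Λ.erase a)) -
      logFrechet V (fun k => Real.exp (-u k)) Zp).PosSemidef) :
    ω.meanEnergy (hubbardTTPrimeFermionInteraction t t' U) 1 -
        1 / β * (ω.expect Λ (G - fermionEmbed (PolySite.incl (Finset.erase_subset a Λ)) GW)).re ≤
      -W / β + c / β :=
  h.meanEnergy_sub_re_expect_div_le_of_sectorGibbs_window_of_pressureFloor t t' U hn0 hn2 hβ hLs hW ha hmax hΛ _
    fun _ hσ hσtr => fermion_condFreeEnergy_le_of_liebCertificate ha hmax hσ hσtr hG hV hGW hZ hcert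

end InfVolFermionState

end Limit

end Literature.MathematicalPhysics.QuantumLattice

end
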